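/-
Copyright (c) 2026 the pub-hodgecm-mathlib formalisation cell (harness21).  R90-TF SLAB, section S10 (Rogawski 1990, §13.6–13.8 read at `v`),
prover R90-C138-p02 (g2) — DEAL #51 (3″) «the PINNED transfer letters» (dealer R90-C138-plan (g3) 2026-09-05T02:33:09Z (2), RULING J-PIN (FINAL) 02:32:33Z (d)(e));
h413 = `stmt-HodgeConjecture-24833`, route `HCCMUnconditional`.
-/
import Summits.HodgeConjecture.HodgeConjecture.Theorems.R90S10SphericalConstituentTraceOfGerm        -- ★ p864629 (this seat, J3): `exists_liesOver_of_pinnedPartner`, `liesOver_of_germ_of_pinnedPartner`, `measureReal_level_ne_zero`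
import Summits.HodgeConjecture.HodgeConjecture.Theorems.R90S10PSLocalCharTransferAbstractLetters    -- ★ p864224 (p01): (3′) `PSLocalCharTransferAbstractLetter` (+ ★ (3), ★ (M3) bridge, ★ C2)
import Literature.NumberTheory.Automorphic.LocalUnitaryIntegralLevel                               -- ★ `isCompact_isOpen_cmLocalIntegralLevel`
import HarnessLib

/-!
# R90-TF ∕ S10 — (3″) THE PINNED TRANSFER LETTERS: Lemma 4.9.2's transfer partner `I` of `ρ_w` WITH ITS HECKE PARAMETER EXPOSED
# (`Theorems/R90S10PSLocalCharTransferPinnedLetters.lean`; ns `Summit.HodgeConjecture.HodgeConjecture.R90.S10`; DEFINITIONS (`def … : Prop`, `Iff.rfl` read-backs) + proved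
# bridges; no instance, no notation, no named fact, no `sorry`; LAW L9: ★ `Theorems` ∕ `Literature` imports only)

Print: [Rogawski1990] §4.9 Lemma 4.9.2 pp. 55–56 («`Tr i_H(χ)(f^H) = ε · Tr i_G(χ̃)(f)`», `ε_w = κ_w = 1` at unramified data); §12.2 pp. 173–174 (the `K_w`-spherical line of
`i_G(χ̃)` and its Satake parameter); §13.1 p. 199 ¶3 («`χ_ρ(f^H) = χ_π(f)` where `π = i_G(χ̃)`»); §13.6 p. 209 («e.v.p.» `t(π) = {t_{π_v}}`); §13.8 p. 218 L5–7 («the sum is over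
cuspidal `π` on `G` such that `ψ_G(t(π)) = t`»), p. 219 L2–L3 («`π_v = ξ_H(ρ_v)` for all `v ≠ w`»).  [CartierCorvallis1979] §IV.1 Cor. 4.1–4.2.

## WHY (RULING J-PIN (FINAL), dealer 02:32:33Z (d)(e); p02 census 02:4xZ)
Row 6 of FILE D at the germ of record — the pin (P-rig) ★ `RigidityAtGermLetter 𝔣 (germOfDiscreteClass {v}) t₀`, `t₀` a PARAMETER all the way up (J-D5-1, J-PIN (e)) — is paid
by p07's glue `rigidityAtGermLetter_of_exists_liesOver` from ONE binder per place `w ≠ v`,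
`hex w : ∃ π₀, π₀.IsAdmissible ∧ ∃ h₀, unopClassSphericalCharacter (K w) π₀ h₀ = t₀ w ∧ LiesOver … π₀ (ρ w)` («`ξ_H(ρ_w)` EXISTS as an admissible `K_w`-spherical class with
Hecke character `(t₀)_w` lying over `ρ_w`»), and ★ p864629 §4 `exists_liesOver_of_pinnedPartner` pays `hex w` from a transfer partner `I` of `ρ_w` ((β″) ★ `LocalCharTransferLetter`)
that is admissible with a `K_w`-LINE and WHOSE PARAMETER `unopSphericalCharacter (K w) I _` IS `t₀ w` — i.e. from ★ (3′) `PSLocalCharTransferAbstractLetter`'s witness PLUS ONE PIN.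
★ (3′) hides `I` (and its parameter) in an `∃`; this file states the letter WITH THE PARAMETER EXPOSED, in the two shapes the consumers need:
* §1 (telescope, dealer's bytes) **`PSLocalCharTransferPinnedLetter L μ w KG KHw νQw νHw mHw mQw t`** for a PIN FUNCTION `t χ₂ χ₁ : ℋ(G_w, KG) →ₐ[ℂ] ℂ` of the inducing data
  `ρ_w ≅ i_H(χ₂ ⊠ χ₁)`: ★ (3′)'s telescope VERBATIM (⟪U⟫ guard at `w`, level pins `KG = U(Φ₃)(𝒪_w)`, `KHw = U(Φ₂)(𝒪_w) × U(Φ₁)(𝒪_w)`, unit volumes, every irreducible-type datum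
  with a `K_H`-line), conclusion `∃ W I, I.IsAdmissible ∧ dim I^{KG} = 1 ∧ (β″)-body ∧ ∃ hline, unopSphericalCharacter KG I hline = t χ₂ χ₁` (print: `t χ₂ χ₁ = 𝒮_G(χ̃ μ̃)`, the Satake
  parameter of the base-changed inducing character [§12.2]; payer = ★ p864450's construction re-run with `I = i_G(χ̃)` exposed + K2E3-p06's #47 «`unopSphericalCharacter K (i_G(χ)) = 𝒮(χ)`»,
  once S3's ★ `inducedCharTransferSigned_general` exports its `χ̃`); `_iff`; `psLocalCharTransferAbstractLetter_of_pinnedLetter` (forget the pin).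
* §2 (pointwise, at the datum) **`PSLocalCharTransferPinnedAt L μ w KG νQw νHw mHw mQw ρw t`** := «`ρ_w` HAS an admissible transfer partner `I` with a `KG`-line OF PARAMETER `t`»:
  `∃ W I, I.IsAdmissible ∧ (∃ hline : dim I^{KG} = 1, unopSphericalCharacter KG I hline = t) ∧ LocalCharTransferLetter L μ w νQw νHw mHw mQw ρw I`; `_iff`;
  `pinnedAt_of_pinnedLetter` (the telescope read at the datum gives the pointwise statement at `t χ₂ χ₁`); **`exists_pinnedAt_of_abstractLetter`** — ★ (3′) read at the datum gives
  `∃ t, PSLocalCharTransferPinnedAt … ρw t` CHOICE-FREE (`t :=` the parameter of the (3′) witness): RULING J-PIN (e)'s «the record `t₀ w` := the germ of the (J)-partner», so that the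
  keystone may TAKE `t₀ w` from here, after which `hex w` holds by construction (§3).
* §3 bridges onto p07's binders: **`exists_liesOver_of_pinnedAt`** (`PSLocalCharTransferPinnedAt … ρw t →` the `hex w` body at level `KG`: `∃ π₀` admissible `KG`-spherical,
  `unopClassSphericalCharacter KG π₀ _ = t ∧ LiesOver L μ w KG KHw νQw νHw mHw mQw π₀ ρw`, ★ §4) and `liesOver_of_germ_of_pinnedAt` (the `hLO w` body: EVERY admissible `KG`-spherical class
  of eigencharacter `t` lies over `ρ_w`); `exists_liesOver_of_pinnedLetter` (telescope form, the guards of ★ bridge′ VERBATIM; `hKo hKc` derived from `hKG` by ★ `isCompact_isOpen_cmLocalIntegralLevel`).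
These are PREDICATES of the local data (nothing is asserted) and bookkeeping over ★; the number theory sits in the payers ((3′): ★ p864450 non-split ∕ ★ p864269 + ★ p864622 split, via p01's
(J) junction; the pin: #47's Satake lemma at `i_G(χ̃)`).
HONEST LABEL: definitions + bridges pay nothing by themselves; row 6 at `w ≠ v` = (3′) witness + its pin (FL-spherical ∕ Satake class, named not hidden); HC_CM is proved only modulo the 7
printed citations (2 remaining named inputs: hLiu418 = `stmt-HodgeConjecture-24832`, h413 = `stmt-HodgeConjecture-24833`) until rung 0 closes; REL ≠ ★ ≠ BUILT.

## References
* [Rogawski1990] J. D. Rogawski, *Automorphic Representations of Unitary Groups in Three Variables*, Ann. of Math. Stud. 123 (1990), §4.9 Lemma 4.9.2, (4.9.2), (4.9.4) pp. 55–56;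
  §12.2 pp. 173–174; §13.1 p. 199 ¶3; §13.6 p. 209; §13.8 p. 218 L5–7, L9 (ii), p. 219 L2–L3.
* [CartierCorvallis1979] P. Cartier, *Representations of 𝔭-adic groups: a survey*, Proc. Sympos. Pure Math. 33.1 (1979), §IV.1 Thm. 4.1, Cor. 4.1–4.2.
* [vanDijk1972] G. van Dijk, *Computation of certain induced characters of 𝔭-adic groups*, Math. Ann. 199 (1972), Thm. p. 237.
-/

set_option autoImplicit false
set_option linter.dupNamespace false

noncomputable section

open scoped RestrictedProduct Matrix MatrixGroups
open Filter MeasureTheory NumberField IsDedekindDomain CompactlySupported MulAction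
open Literature.NumberTheory.Rogawski1990 Literature.NumberTheory.Automorphic Literature.NumberTheory.Automorphic.UnitaryGroup
open Literature.NumberTheory.Automorphic.UnitaryGroup.CotangentForms Literature.NumberTheory.GaloisRepresentations
open Summit.HodgeConjecture.HodgeConjecture.Cruxes.H413.K2E1TraceFormulaBeta
open Summit.HodgeConjecture.HodgeConjecture.Cruxes.H413.K2E1EigenvaluePackageOfSpherical
open Summit.HodgeConjecture.HodgeConjecture.Cruxes.H413.K2E1EvpOfAutomorphicClass

namespace Summit.HodgeConjecture.HodgeConjecture.R90.S10

/-! ## §1 (3″) telescope form: ★ (3′) VERBATIM with the partner's parameter PINNED by a function of the inducing data -/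

/-- **(3″) `PSLocalCharTransferPinnedLetter L μ w KG KHw νQw νHw mHw mQw t`** — ★ (3′) `PSLocalCharTransferAbstractLetter` (⟪U⟫ guard at `w`, hyperspecial level pins
`KG = U(Φ₃)(𝒪_w)`, `KHw = U(Φ₂)(𝒪_w) × U(Φ₁)(𝒪_w)`, unit volumes; every irreducible-type datum `ρ_w ≅ i_H(χ₂ ⊠ χ₁)`, `χ₁` smooth, with a `K_H`-line) TOKEN FOR TOKEN, the
conclusion's `∃` EXTENDED by the PIN `∧ ∃ hline, unopSphericalCharacter KG I hline = t χ₂ χ₁`: the ADMISSIBLE transfer partner `I` of `ρ_w` (`I^{KG}` a LINE carrying the (β″)-body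
`∀ (f^H, φ)` C2-matched, `Tr I(φ) = Tr ρ_w(f^H)`) has Hecke PARAMETER `t χ₂ χ₁ : ℋ(G_w, KG) →ₐ[ℂ] ℂ`, a prescribed FUNCTION of the inducing data.  Print: `I = i_G(χ̃ μ̃)` and
`t χ₂ χ₁ = 𝒮_G(χ̃ μ̃)`, its Satake parameter [Lemma 4.9.2, `ε_w = κ_w = 1`; §12.2; p. 199 ¶3].  Why it might fail: only through the `Δ‴` of record differing from print's `Δ` by a sign
at `w` (as for (3)∕(3′)), or a pin function `t` not matching the payer's `χ̃`.  A predicate; nothing is asserted.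
[cite: Rogawski1990, §4.9 Lemma 4.9.2, (4.9.2), (4.9.4) pp. 55–56; §12.2 pp. 173–174; §13.1 p. 199 ¶3; §13.8 p. 218 L9 (ii), p. 219 L3] [cite: vanDijk1972, Thm. p. 237] -/
def PSLocalCharTransferPinnedLetter (L : Type) [Field L] [NumberField L] [IsCMField L] (μ : HeckeCharacter L) (w : Pl L)
    {_msH : MeasurableSpace (HLoc L w)} {_msG : MeasurableSpace (Gqs L w)} [BorelSpace (HLoc L w)] [BorelSpace (Gqs L w)]
    {_qH : ∀ a : HLoc L w, MeasurableSpace (HLoc L w ⧸ Subgroup.centralizer ({a} : Set (HLoc L w)))}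
    {_qQ : ∀ γ : Gqs L w, MeasurableSpace (Gqs L w ⧸ Subgroup.centralizer ({γ} : Set (Gqs L w)))}
    (KG : Subgroup (Gqs L w)) (KHw : Subgroup (HLoc L w)) (νQw : Measure (Gqs L w)) (νHw : Measure (HLoc L w))
    [νQw.IsHaarMeasure] [νHw.IsHaarMeasure] (mHw : OrbitalMeasureFamily (HLoc L w)) (mQw : OrbitalMeasureFamily (Gqs L w))
    (t : (↥(torusU (conjLocal L (IsCMField.complexConj L) w) (cmLocalForm L 2 w)) →* ℂˣ) → (H1Loc L w →* ℂˣ) → (heckeAlgebra ℂ (Gqs L w) KG →ₐ[ℂ] ℂ)) : Prop :=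
  (∀ W : PlacesOver L w, Algebra.IsUnramifiedAt (𝓞 ↥(maximalRealSubfield L)) W.1.asIdeal ∧ μ.IsUnramifiedAt W.1) →
    KG = cmLocalIntegralLevel L 3 (qsForm L) w →
    KHw = (cmLocalIntegralLevel L 2 (Matrix.of fun i j : Fin 2 => if i.val + j.val + 1 = 2 then (1 : L) else 0) w).prod
      (cmLocalIntegralLevel L 1 (Matrix.of fun i j : Fin 1 => if i.val + j.val + 1 = 1 then (1 : L) else 0) w) →
    νHw (KHw : Set (HLoc L w)) = 1 → νQw (KG : Set (Gqs L w)) = 1 →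
      ∀ (χ₂ : ↥(torusU (conjLocal L (IsCMField.complexConj L) w) (cmLocalForm L 2 w)) →* ℂˣ) (χ₁ : H1Loc L w →* ℂˣ),
        IsOpen ((χ₁.ker : Subgroup (H1Loc L w)) : Set (H1Loc L w)) →
          ∀ ⦃Vw : Type⦄ [AddCommGroup Vw] [Module ℂ Vw] (ρw : Representation ℂ (HLoc L w) Vw),
            Nonempty (ρw.Equiv (cmPrincipalSeriesH L w χ₂ χ₁)) → Module.finrank ℂ ↥(ρw.fixedPoints KHw) = 1 →
              ∃ (W : Type) (_ : AddCommGroup W) (_ : Module ℂ W) (I : Representation ℂ (Gqs L w) W),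
                I.IsAdmissible ∧ Module.finrank ℂ ↥(I.fixedPoints KG) = 1 ∧
                  (∀ (fH : HLoc L w → ℂ) (φ : Gqs L w → ℂ), MatchE1 L μ w mHw mQw fH φ → I.smoothTrace νQw φ = ρw.smoothTrace νHw fH) ∧
                    ∃ hline : Module.finrank ℂ ↥(I.fixedPoints KG) = 1, unopSphericalCharacter KG I hline = t χ₂ χ₁

/-- Read-back, `Iff.rfl`. [cite: Rogawski1990, §4.9 Lemma 4.9.2 pp. 55–56] -/
theorem psLocalCharTransferPinnedLetter_iff (L : Type) [Field L] [NumberField L] [IsCMField L] (μ : HeckeCharacter L) (w : Pl L)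
    {_msH : MeasurableSpace (HLoc L w)} {_msG : MeasurableSpace (Gqs L w)} [BorelSpace (HLoc L w)] [BorelSpace (Gqs L w)]
    {_qH : ∀ a : HLoc L w, MeasurableSpace (HLoc L w ⧸ Subgroup.centralizer ({a} : Set (HLoc L w)))}
    {_qQ : ∀ γ : Gqs L w, MeasurableSpace (Gqs L w ⧸ Subgroup.centralizer ({γ} : Set (Gqs L w)))}
    (KG : Subgroup (Gqs L w)) (KHw : Subgroup (HLoc L w)) (νQw : Measure (Gqs L w)) (νHw : Measure (HLoc L w))
    [νQw.IsHaarMeasure] [νHw.IsHaarMeasure] (mHw : OrbitalMeasureFamily (HLoc L w)) (mQw : OrbitalMeasureFamily (Gqs L w))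
    (t : (↥(torusU (conjLocal L (IsCMField.complexConj L) w) (cmLocalForm L 2 w)) →* ℂˣ) → (H1Loc L w →* ℂˣ) → (heckeAlgebra ℂ (Gqs L w) KG →ₐ[ℂ] ℂ)) :
    PSLocalCharTransferPinnedLetter L μ w KG KHw νQw νHw mHw mQw t ↔
      ((∀ W : PlacesOver L w, Algebra.IsUnramifiedAt (𝓞 ↥(maximalRealSubfield L)) W.1.asIdeal ∧ μ.IsUnramifiedAt W.1) →
        KG = cmLocalIntegralLevel L 3 (qsForm L) w →
        KHw = (cmLocalIntegralLevel L 2 (Matrix.of fun i j : Fin 2 => if i.val + j.val + 1 = 2 then (1 : L) else 0) w).prod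
          (cmLocalIntegralLevel L 1 (Matrix.of fun i j : Fin 1 => if i.val + j.val + 1 = 1 then (1 : L) else 0) w) →
        νHw (KHw : Set (HLoc L w)) = 1 → νQw (KG : Set (Gqs L w)) = 1 →
          ∀ (χ₂ : ↥(torusU (conjLocal L (IsCMField.complexConj L) w) (cmLocalForm L 2 w)) →* ℂˣ) (χ₁ : H1Loc L w →* ℂˣ),
            IsOpen ((χ₁.ker : Subgroup (H1Loc L w)) : Set (H1Loc L w)) →
              ∀ ⦃Vw : Type⦄ [AddCommGroup Vw] [Module ℂ Vw] (ρw : Representation ℂ (HLoc L w) Vw),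
                Nonempty (ρw.Equiv (cmPrincipalSeriesH L w χ₂ χ₁)) → Module.finrank ℂ ↥(ρw.fixedPoints KHw) = 1 →
                  ∃ (W : Type) (_ : AddCommGroup W) (_ : Module ℂ W) (I : Representation ℂ (Gqs L w) W),
                    I.IsAdmissible ∧ Module.finrank ℂ ↥(I.fixedPoints KG) = 1 ∧
                      (∀ (fH : HLoc L w → ℂ) (φ : Gqs L w → ℂ), MatchE1 L μ w mHw mQw fH φ → I.smoothTrace νQw φ = ρw.smoothTrace νHw fH) ∧
                        ∃ hline : Module.finrank ℂ ↥(I.fixedPoints KG) = 1, unopSphericalCharacter KG I hline = t χ₂ χ₁) :=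
  Iff.rfl

/-- **(3″) ⇒ (3′)**: forget the pin. [cite: Rogawski1990, §4.9 Lemma 4.9.2 pp. 55–56] -/
theorem psLocalCharTransferAbstractLetter_of_pinnedLetter (L : Type) [Field L] [NumberField L] [IsCMField L] (μ : HeckeCharacter L) (w : Pl L)
    {_msH : MeasurableSpace (HLoc L w)} {_msG : MeasurableSpace (Gqs L w)} [BorelSpace (HLoc L w)] [BorelSpace (Gqs L w)]
    {_qH : ∀ a : HLoc L w, MeasurableSpace (HLoc L w ⧸ Subgroup.centralizer ({a} : Set (HLoc L w)))}
    {_qQ : ∀ γ : Gqs L w, MeasurableSpace (Gqs L w ⧸ Subgroup.centralizer ({γ} : Set (Gqs L w)))}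
    (KG : Subgroup (Gqs L w)) (KHw : Subgroup (HLoc L w)) (νQw : Measure (Gqs L w)) (νHw : Measure (HLoc L w))
    [νQw.IsHaarMeasure] [νHw.IsHaarMeasure] (mHw : OrbitalMeasureFamily (HLoc L w)) (mQw : OrbitalMeasureFamily (Gqs L w))
    {t : (↥(torusU (conjLocal L (IsCMField.complexConj L) w) (cmLocalForm L 2 w)) →* ℂˣ) → (H1Loc L w →* ℂˣ) → (heckeAlgebra ℂ (Gqs L w) KG →ₐ[ℂ] ℂ)}
    (h : PSLocalCharTransferPinnedLetter L μ w KG KHw νQw νHw mHw mQw t) : PSLocalCharTransferAbstractLetter L μ w KG KHw νQw νHw mHw mQw :=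
  fun hU hKG hKH hvolH hvolG χ₂ χ₁ hχ₁ _Vw _ _ ρw hρ hline => by
    obtain ⟨W, _, _, I, hadmI, hlineI, hβI, -⟩ := h hU hKG hKH hvolH hvolG χ₂ χ₁ hχ₁ ρw hρ hline
    exact ⟨W, inferInstance, inferInstance, I, hadmI, hlineI, hβI⟩

/-! ## §2 (3″) pointwise form AT THE DATUM: «`ρ_w` has an admissible transfer partner with a `KG`-line OF PARAMETER `t`» -/

section Pointwise

variable (L : Type) [Field L] [NumberField L] [IsCMField L] (μ : HeckeCharacter L) (w : Pl L)

/-- **(3″-pt) `PSLocalCharTransferPinnedAt L μ w KG νQw νHw mHw mQw ρw t`** — «`ρ_w` HAS an ADMISSIBLE transfer partner `I` on `G_w = U(Φ₃)(L⁺_w)` with a LINE of `KG`-fixed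
vectors OF PARAMETER `t`»: `∃ W I, I.IsAdmissible ∧ (∃ hline : dim I^{KG} = 1, unopSphericalCharacter KG I hline = t) ∧ LocalCharTransferLetter L μ w νQw νHw mHw mQw ρw I` (★ (β″): the
character of `ρ_w` `Δ‴_w`-transfers to that of `I` on every C2-matched pair).  Print: `I = i_G(χ̃ μ̃)` for `ρ_w ≅ i_H(χ₂ ⊠ χ₁)` unramified, `t = 𝒮_G(χ̃ μ̃) = (ξ_H t(ρ))_w`
[Lemma 4.9.2; §13.1 p. 199 ¶3; §13.6 p. 209].  The pointwise statement the keystone binds at `t := t₀ w` (RULING J-PIN (e)); obtained from the telescope §1 at the datum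
(`pinnedAt_of_pinnedLetter`) or, CHOICE-FREE with `t :=` the witness's own parameter, from ★ (3′) (`exists_pinnedAt_of_abstractLetter`).  A predicate; nothing is asserted.
[cite: Rogawski1990, §4.9 Lemma 4.9.2 pp. 55–56; §13.1 p. 199 ¶3; §13.6 p. 209; §13.8 p. 219 L3] [cite: CartierCorvallis1979, §IV.1 Cor. 4.1–4.2] -/
def PSLocalCharTransferPinnedAt {_msH : MeasurableSpace (HLoc L w)} {_msG : MeasurableSpace (Gqs L w)}
    {_qH : ∀ a : HLoc L w, MeasurableSpace (HLoc L w ⧸ Subgroup.centralizer ({a} : Set (HLoc L w)))}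
    {_qQ : ∀ γ : Gqs L w, MeasurableSpace (Gqs L w ⧸ Subgroup.centralizer ({γ} : Set (Gqs L w)))}
    (KG : Subgroup (Gqs L w)) (νQw : Measure (Gqs L w)) (νHw : Measure (HLoc L w))
    (mHw : OrbitalMeasureFamily (HLoc L w)) (mQw : OrbitalMeasureFamily (Gqs L w))
    {Vw : Type} {_acV : AddCommGroup Vw} {_mdV : Module ℂ Vw} (ρw : Representation ℂ (HLoc L w) Vw) (t : heckeAlgebra ℂ (Gqs L w) KG →ₐ[ℂ] ℂ) : Prop :=
  ∃ (W : Type) (_ : AddCommGroup W) (_ : Module ℂ W) (I : Representation ℂ (Gqs L w) W),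
    I.IsAdmissible ∧ (∃ hline : Module.finrank ℂ ↥(I.fixedPoints KG) = 1, unopSphericalCharacter KG I hline = t) ∧
      LocalCharTransferLetter L μ w νQw νHw mHw mQw ρw I

/-- Read-back, `Iff.rfl`. [cite: Rogawski1990, §4.9 Lemma 4.9.2 pp. 55–56] -/
theorem psLocalCharTransferPinnedAt_iff {_msH : MeasurableSpace (HLoc L w)} {_msG : MeasurableSpace (Gqs L w)}
    {_qH : ∀ a : HLoc L w, MeasurableSpace (HLoc L w ⧸ Subgroup.centralizer ({a} : Set (HLoc L w)))}
    {_qQ : ∀ γ : Gqs L w, MeasurableSpace (Gqs L w ⧸ Subgroup.centralizer ({γ} : Set (Gqs L w)))}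
    (KG : Subgroup (Gqs L w)) (νQw : Measure (Gqs L w)) (νHw : Measure (HLoc L w))
    (mHw : OrbitalMeasureFamily (HLoc L w)) (mQw : OrbitalMeasureFamily (Gqs L w))
    {Vw : Type} {_acV : AddCommGroup Vw} {_mdV : Module ℂ Vw} (ρw : Representation ℂ (HLoc L w) Vw) (t : heckeAlgebra ℂ (Gqs L w) KG →ₐ[ℂ] ℂ) :
    PSLocalCharTransferPinnedAt L μ w KG νQw νHw mHw mQw ρw t ↔
      ∃ (W : Type) (_ : AddCommGroup W) (_ : Module ℂ W) (I : Representation ℂ (Gqs L w) W),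
        I.IsAdmissible ∧ (∃ hline : Module.finrank ℂ ↥(I.fixedPoints KG) = 1, unopSphericalCharacter KG I hline = t) ∧
          LocalCharTransferLetter L μ w νQw νHw mHw mQw ρw I :=
  Iff.rfl

variable [MeasurableSpace (HLoc L w)] [BorelSpace (HLoc L w)] [MeasurableSpace (Gqs L w)] [BorelSpace (Gqs L w)]
  [∀ a : HLoc L w, MeasurableSpace (HLoc L w ⧸ Subgroup.centralizer ({a} : Set (HLoc L w)))]
  [∀ γ : Gqs L w, MeasurableSpace (Gqs L w ⧸ Subgroup.centralizer ({γ} : Set (Gqs L w)))]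
  (KG : Subgroup (Gqs L w)) (KHw : Subgroup (HLoc L w)) (νQw : Measure (Gqs L w)) (νHw : Measure (HLoc L w))
  [νQw.IsHaarMeasure] [νHw.IsHaarMeasure] (mHw : OrbitalMeasureFamily (HLoc L w)) (mQw : OrbitalMeasureFamily (Gqs L w))

/-- **THE TELESCOPE READ AT THE DATUM**: (3″) for the pin function `t`, under its guards (⟪U⟫ at `w`, level pins, unit volumes) and for `ρ_w ≅ i_H(χ₂ ⊠ χ₁)` (`χ₁` smooth) with a
`K_H`-line, gives the pointwise (3″-pt) at the parameter `t χ₂ χ₁`. [cite: Rogawski1990, §4.9 Lemma 4.9.2 pp. 55–56; §13.1 p. 199 ¶3] -/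
theorem pinnedAt_of_pinnedLetter
    {t : (↥(torusU (conjLocal L (IsCMField.complexConj L) w) (cmLocalForm L 2 w)) →* ℂˣ) → (H1Loc L w →* ℂˣ) → (heckeAlgebra ℂ (Gqs L w) KG →ₐ[ℂ] ℂ)}
    (h : PSLocalCharTransferPinnedLetter L μ w KG KHw νQw νHw mHw mQw t)
    (hU : ∀ W : PlacesOver L w, Algebra.IsUnramifiedAt (𝓞 ↥(maximalRealSubfield L)) W.1.asIdeal ∧ μ.IsUnramifiedAt W.1)
    (hKG : KG = cmLocalIntegralLevel L 3 (qsForm L) w)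
    (hKH : KHw = (cmLocalIntegralLevel L 2 (Matrix.of fun i j : Fin 2 => if i.val + j.val + 1 = 2 then (1 : L) else 0) w).prod
      (cmLocalIntegralLevel L 1 (Matrix.of fun i j : Fin 1 => if i.val + j.val + 1 = 1 then (1 : L) else 0) w))
    (hvolH : νHw (KHw : Set (HLoc L w)) = 1) (hvolG : νQw (KG : Set (Gqs L w)) = 1)
    (χ₂ : ↥(torusU (conjLocal L (IsCMField.complexConj L) w) (cmLocalForm L 2 w)) →* ℂˣ) (χ₁ : H1Loc L w →* ℂˣ)
    (hχ₁ : IsOpen ((χ₁.ker : Subgroup (H1Loc L w)) : Set (H1Loc L w)))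
    {Vw : Type} [AddCommGroup Vw] [Module ℂ Vw] (ρw : Representation ℂ (HLoc L w) Vw)
    (hρ : Nonempty (ρw.Equiv (cmPrincipalSeriesH L w χ₂ χ₁))) (hline : Module.finrank ℂ ↥(ρw.fixedPoints KHw) = 1) :
    PSLocalCharTransferPinnedAt L μ w KG νQw νHw mHw mQw ρw (t χ₂ χ₁) := by
  obtain ⟨W, _, _, I, hadmI, -, hβI, hpin⟩ := h hU hKG hKH hvolH hvolG χ₂ χ₁ hχ₁ ρw hρ hline
  exact ⟨W, inferInstance, inferInstance, I, hadmI, hpin, hβI⟩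

/-- **★ (3′) READ AT THE DATUM PINS ITSELF, CHOICE-FREE**: under the guards and for `ρ_w ≅ i_H(χ₂ ⊠ χ₁)` with a `K_H`-line, ★ (3′) `PSLocalCharTransferAbstractLetter` yields
`∃ t, PSLocalCharTransferPinnedAt … ρw t` — `t :=` THE PARAMETER `unopSphericalCharacter KG I _` OF THE WITNESS `I` (RULING J-PIN (e): «the record `t₀ w` := the germ of the
(J)-partner»; the keystone may take `t₀ w` from this `∃`, and then `hex w` holds by §3 with no further pin).  The number theory identifying this `t` with `𝒮_G(χ̃ μ̃) = (ξ_H t(ρ))_w` is the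
Satake ∕ FL-spherical class input consumed ELSEWHERE (S5's `hH4`, `hbc`), named there. [cite: Rogawski1990, §13.6 p. 209; §13.8 p. 219 L3; §4.9 Lemma 4.9.2 pp. 55–56]
[cite: CartierCorvallis1979, §IV.1 Cor. 4.1–4.2] -/
theorem exists_pinnedAt_of_abstractLetter (hβ : PSLocalCharTransferAbstractLetter L μ w KG KHw νQw νHw mHw mQw)
    (hU : ∀ W : PlacesOver L w, Algebra.IsUnramifiedAt (𝓞 ↥(maximalRealSubfield L)) W.1.asIdeal ∧ μ.IsUnramifiedAt W.1)
    (hKG : KG = cmLocalIntegralLevel L 3 (qsForm L) w)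
    (hKH : KHw = (cmLocalIntegralLevel L 2 (Matrix.of fun i j : Fin 2 => if i.val + j.val + 1 = 2 then (1 : L) else 0) w).prod
      (cmLocalIntegralLevel L 1 (Matrix.of fun i j : Fin 1 => if i.val + j.val + 1 = 1 then (1 : L) else 0) w))
    (hvolH : νHw (KHw : Set (HLoc L w)) = 1) (hvolG : νQw (KG : Set (Gqs L w)) = 1)
    (χ₂ : ↥(torusU (conjLocal L (IsCMField.complexConj L) w) (cmLocalForm L 2 w)) →* ℂˣ) (χ₁ : H1Loc L w →* ℂˣ)
    (hχ₁ : IsOpen ((χ₁.ker : Subgroup (H1Loc L w)) : Set (H1Loc L w)))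
    {Vw : Type} [AddCommGroup Vw] [Module ℂ Vw] (ρw : Representation ℂ (HLoc L w) Vw)
    (hρ : Nonempty (ρw.Equiv (cmPrincipalSeriesH L w χ₂ χ₁))) (hline : Module.finrank ℂ ↥(ρw.fixedPoints KHw) = 1) :
    ∃ t : heckeAlgebra ℂ (Gqs L w) KG →ₐ[ℂ] ℂ, PSLocalCharTransferPinnedAt L μ w KG νQw νHw mHw mQw ρw t := by
  obtain ⟨W, _, _, I, hadmI, hlineI, hβI⟩ := hβ hU hKG hKH hvolH hvolG χ₂ χ₁ hχ₁ ρw hρ hline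
  exact ⟨unopSphericalCharacter KG I hlineI, W, inferInstance, inferInstance, I, hadmI, ⟨hlineI, rfl⟩, hβI⟩

/-! ## §3 Bridges onto the ROW-6 binders of p07's glue: the `hex w` body (∃-form) and the `hLO w` body ((L⇒)) at level `KG` -/

omit [BorelSpace (HLoc L w)] [νHw.IsHaarMeasure] in
/-- **(3″-pt) ⇒ THE `hex w` BODY — «`ξ_H(ρ_w)` EXISTS as an admissible `KG`-spherical class WITH HECKE CHARACTER `t` LYING OVER `ρ_w`»**: the spherical constituent of the pinned partner
(★ p864629 §4 `exists_liesOver_of_pinnedPartner`; `KG` compact open). [cite: Rogawski1990, §13.8 p. 219 L2–L3; §4.9 Lemma 4.9.2 pp. 55–56; §13.6 p. 209]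
[cite: CartierCorvallis1979, §IV.1 Cor. 4.1–4.2] -/
theorem exists_liesOver_of_pinnedAt (hKo : IsOpen (KG : Set (Gqs L w))) (hKc : IsCompact (KG : Set (Gqs L w)))
    {Vw : Type} [AddCommGroup Vw] [Module ℂ Vw] (ρw : Representation ℂ (HLoc L w) Vw) {t : heckeAlgebra ℂ (Gqs L w) KG →ₐ[ℂ] ℂ}
    (h : PSLocalCharTransferPinnedAt L μ w KG νQw νHw mHw mQw ρw t) :
    ∃ π₀ : IrrClass (Gqs L w), π₀.IsAdmissible ∧ ∃ h₀ : π₀.IsSpherical KG,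
      unopClassSphericalCharacter KG π₀ h₀ = t ∧ LiesOver L μ w KG KHw νQw νHw mHw mQw π₀ ρw := by
  obtain ⟨W, _, _, I, hadmI, ⟨hlineI, hIt⟩, hβI⟩ := h
  exact exists_liesOver_of_pinnedPartner L μ w KG KHw νQw νHw mHw mQw hKo hKc t ρw I hadmI hlineI hIt hβI

omit [BorelSpace (HLoc L w)] [νHw.IsHaarMeasure] in
/-- **(3″-pt) ⇒ THE `hLO w` BODY — EVERY admissible `KG`-spherical class OF EIGENCHARACTER `t` LIES OVER `ρ_w`** (e.v.p. rigidity against the constituent of the pinned partner, ★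
p864629 `liesOver_of_germ_of_pinnedPartner`). [cite: Rogawski1990, §13.8 p. 219 L2–L3; §13.6 p. 209] [cite: CartierCorvallis1979, §IV.1 Thm. 4.1, Cor. 4.1–4.2] -/
theorem liesOver_of_germ_of_pinnedAt (hKo : IsOpen (KG : Set (Gqs L w))) (hKc : IsCompact (KG : Set (Gqs L w)))
    {Vw : Type} [AddCommGroup Vw] [Module ℂ Vw] (ρw : Representation ℂ (HLoc L w) Vw) {t : heckeAlgebra ℂ (Gqs L w) KG →ₐ[ℂ] ℂ}
    (h : PSLocalCharTransferPinnedAt L μ w KG νQw νHw mHw mQw ρw t)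
    (πw : IrrClass (Gqs L w)) (hadm : πw.IsAdmissible) (hsph : πw.IsSpherical KG) (hπt : unopClassSphericalCharacter KG πw hsph = t) :
    LiesOver L μ w KG KHw νQw νHw mHw mQw πw ρw := by
  obtain ⟨W, _, _, I, hadmI, ⟨hlineI, hIt⟩, hβI⟩ := h
  exact liesOver_of_germ_of_pinnedPartner L μ w KG KHw νQw νHw mHw mQw hKo hKc t ρw I hadmI hlineI hIt hβI πw hadm hsph hπt

/-- **THE TELESCOPE ⇒ THE `hex w` BODY at `KG = U(Φ₃)(𝒪_w)`** (★ bridge′'s guards VERBATIM; `KG` is compact open by ★ `isCompact_isOpen_cmLocalIntegralLevel` after `hKG`): under ⟪U⟫ at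
`w`, the level pins and unit volumes, for `ρ_w ≅ i_H(χ₂ ⊠ χ₁)` with a `K_H`-line there is an admissible `KG`-spherical class of Hecke character `t χ₂ χ₁` lying over `ρ_w`.
[cite: Rogawski1990, §13.8 p. 219 L2–L3; §4.9 Lemma 4.9.2 pp. 55–56; §13.6 p. 209] [cite: CartierCorvallis1979, §IV.1 Cor. 4.1–4.2] -/
theorem exists_liesOver_of_pinnedLetter
    {t : (↥(torusU (conjLocal L (IsCMField.complexConj L) w) (cmLocalForm L 2 w)) →* ℂˣ) → (H1Loc L w →* ℂˣ) → (heckeAlgebra ℂ (Gqs L w) KG →ₐ[ℂ] ℂ)}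
    (h : PSLocalCharTransferPinnedLetter L μ w KG KHw νQw νHw mHw mQw t)
    (hU : ∀ W : PlacesOver L w, Algebra.IsUnramifiedAt (𝓞 ↥(maximalRealSubfield L)) W.1.asIdeal ∧ μ.IsUnramifiedAt W.1)
    (hKG : KG = cmLocalIntegralLevel L 3 (qsForm L) w)
    (hKH : KHw = (cmLocalIntegralLevel L 2 (Matrix.of fun i j : Fin 2 => if i.val + j.val + 1 = 2 then (1 : L) else 0) w).prod
      (cmLocalIntegralLevel L 1 (Matrix.of fun i j : Fin 1 => if i.val + j.val + 1 = 1 then (1 : L) else 0) w))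
    (hvolH : νHw (KHw : Set (HLoc L w)) = 1) (hvolG : νQw (KG : Set (Gqs L w)) = 1)
    (χ₂ : ↥(torusU (conjLocal L (IsCMField.complexConj L) w) (cmLocalForm L 2 w)) →* ℂˣ) (χ₁ : H1Loc L w →* ℂˣ)
    (hχ₁ : IsOpen ((χ₁.ker : Subgroup (H1Loc L w)) : Set (H1Loc L w)))
    {Vw : Type} [AddCommGroup Vw] [Module ℂ Vw] (ρw : Representation ℂ (HLoc L w) Vw)
    (hρ : Nonempty (ρw.Equiv (cmPrincipalSeriesH L w χ₂ χ₁))) (hline : Module.finrank ℂ ↥(ρw.fixedPoints KHw) = 1) :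
    ∃ π₀ : IrrClass (Gqs L w), π₀.IsAdmissible ∧ ∃ h₀ : π₀.IsSpherical KG,
      unopClassSphericalCharacter KG π₀ h₀ = t χ₂ χ₁ ∧ LiesOver L μ w KG KHw νQw νHw mHw mQw π₀ ρw := by
  have hK : IsCompact (KG : Set (Gqs L w)) ∧ IsOpen (KG : Set (Gqs L w)) := by
    rw [hKG]; exact isCompact_isOpen_cmLocalIntegralLevel L 3 (qsForm L) w
  exact exists_liesOver_of_pinnedAt L μ w KG KHw νQw νHw mHw mQw hK.2 hK.1 ρw
    (pinnedAt_of_pinnedLetter L μ w KG KHw νQw νHw mHw mQw h hU hKG hKH hvolH hvolG χ₂ χ₁ hχ₁ ρw hρ hline)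

end Pointwise

end Summit.HodgeConjecture.HodgeConjecture.R90.S10

end
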